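import Literature.Analysis.FluidPDE.NormalisedPressureL2Bound
import HarnessLib

/-!
# The truncated Newtonian potential at a fixed scale: Green's representation and the `L²` bound
# for its Hessian

Analysis/FluidPDE support file for the proof of the nonlinear estimate `Y₆` in Tao's enstrophy
localisation argument (T. Tao, *Localisation and compactness properties of the Navier–Stokes
global regularity problem*, arXiv:1108.1165, §10, proof of Thm. 10.1, pp. 32–33), where the
velocity gradient is recovered *locally* from the vorticity: "On `2Bᵢ`, we thus have the local
Biot-Savart law `u = O(Δ⁻¹∇(ψᵢω)) + v` where `v` is harmonic on `2Bᵢ` […] From Plancherel's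
theorem we have `‖∇Δ⁻¹∇(ψᵢω)‖_{L²} ≲ ‖ψᵢω‖_{L²}`". We realise `Δ⁻¹` at a *fixed scale* by the
truncated Newtonian kernel `Γ₀ = θΓ` of the tree (`newtonNear r₀ r₁`, `FluidPDE/NewtonKernel`,
`Γ = -1/(4π|z|)`, `θ` a radial cutoff equal to `1` on `|z| ≤ r₀` and `0` on `|z| ≥ r₁`), whose
distributional Laplacian is `δ₀ - λ` with `λ = Δ((1-θ)Γ)` (`newtonFarLaplacian r₀ r₁`) smooth and
supported in the shell `r₀ ≤ |z| ≤ r₁` (`NewtonPotential.integral_newtonNear_mul_laplacian`: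
`∫ Γ₀ Δφ = φ(0) - ∫ λ φ`). For the **truncated Newtonian potential** and the **smoothing remainder**

  `N[g](x) = ∫ Γ₀(z) g(x - z) dz`,   `Λ[g](x) = ∫ λ(z) g(x - z) dz`,

this file proves, for compactly supported `g`:

* `N[g]` is `Cⁿ` when `g` is, with derivatives `∂ₐN[g] = N[∂ₐg]`, `∂_c∂ₐN[g] = N[∂_c∂ₐg]`, and has
  compact support (`contDiff_newtonNearPotential`, `fderiv_newtonNearPotential_apply`,
  `fderiv_fderiv_newtonNearPotential_apply`, `hasCompactSupport_newtonNearPotential`);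
* **Green's representation at scale `r₁`**: `ΔN[g] = g - Λ[g]` (`laplacian_newtonNearPotential`),
  i.e. `N = Δ⁻¹` up to the smoothing operator `Λ` of scale `r₁` (unit mass, `L¹`-bounded);
* **Young**: `∫ Λ[g]² ≤ M² ∫ g²`, `M = ∫|λ|` (`integral_sq_newtonFarSmoothing_le`; the tree's
  `Literature.Analysis.UnboundedOperators.eLpNorm_convolution_le_lintegral_enorm_mul`), and `M` is scale invariant,
  `= regLaplacianMass` for the radii `(r/2, r)` (`integral_abs_newtonFarLaplacian_half`);
* **the `L²` bound for the Hessian of the potential** (Tao's "Plancherel" step, here by two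
  integrations by parts, the tree's Hessian–Laplacian identity
  `Σᵢⱼ‖∂ᵢ∂ⱼG‖²_{L²} = ‖ΔG‖²_{L²}`, `FluidPDE/HessianLaplacian`):
  `Σᵢ Σⱼ ∫ (∂ᵢ∂ⱼN[g])² = ∫ (g - Λ[g])² ≤ 2(1 + M²) ∫ g²`
  (`sum_integral_sq_fderiv_fderiv_newtonNearPotential_le`), with no Fourier transform and no
  Calderón–Zygmund theory.

## Mathlib / tree search

Tree (all used): `newtonNear`, `newtonFarLaplacian`, `integrable_newtonNear`,
`integral_newtonNear_mul_laplacian`, `integral_abs_newtonFarLaplacian_scale` (`NewtonKernel`,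
`NewtonPotential`); `contDiff_integral_smul_comp_sub`, `fderiv_integral_smul_comp_sub_apply`,
`laplacian_integral_mul_comp_sub`, `laplacian_comp_const_sub`, `continuous_integral_smul_comp_sub`
(`HarmonicProbe`); `integral_sum_sq_fderiv_fderiv_eq_integral_laplacian_sq` (`HessianLaplacian`);
`convolution_lsmul_apply`, `hasCompactSupport_convolution`, `regLaplacianMass`,
`eLpNorm_two_eq_ofReal_sqrt` (`NormalisedPressureL2Bound`, which proves the analogous bound for the
*regularised* kernel `ε⁻¹Γ∞(·/ε)` uniformly in `ε`; here the exact identity at a fixed scale is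
needed). Mathlib: `Continuous.memLp_of_hasCompactSupport`, `IsCompact.add`.

## References

* T. Tao, arXiv:1108.1165 (`Tao2011`), §10, proof of Thm. 10.1 (pp. 32–33, the local Biot–Savart
  law and "From Plancherel's theorem …").
* D. Gilbarg, N. S. Trudinger, *Elliptic partial differential equations of second order* (2001),
  (2.16)–(2.17) (Green's representation), Thm. 9.9 and (9.27) (`‖D²u‖₂ = ‖Δu‖₂`).
* E. M. Stein, *Singular integrals and differentiability properties of functions* (1970),
  Ch. III §1.3, Prop. 3 (`‖∂ⱼ∂ₖf‖_p ≤ A_p‖Δf‖_p`, `A₂ = 1`).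
-/

noncomputable section

open MeasureTheory Set Filter Topology Function Metric InnerProductSpace
open scoped ENNReal NNReal RealInnerProductSpace ContDiff Laplacian Convolution

namespace Literature.Analysis.FluidPDE

/-- Local notation for physical space `ℝ³ = EuclideanSpace ℝ (Fin 3)`. -/
local notation "ℝ³" => EuclideanSpace ℝ (Fin 3)

section Potential

variable {r₀ r₁ : ℝ} {g : ℝ³ → ℝ}

/-- **The truncated Newtonian potential** `N[g](x) = ∫ Γ₀(z) g(x - z) dz` of `g` at radii
`(r₀, r₁)`, `Γ₀ = newtonNear r₀ r₁ = θΓ` the truncated Newtonian kernel (Gilbarg–Trudinger (2.16),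
localised by the cutoff `θ`). [cite: GilbargTrudinger2001, (2.16)–(2.17)] -/
def newtonNearPotential (r₀ r₁ : ℝ) (g : ℝ³ → ℝ) (x : ℝ³) : ℝ :=
  ∫ z, newtonNear r₀ r₁ z * g (x - z)

/-- **The smoothing remainder** `Λ[g](x) = ∫ λ(z) g(x - z) dz`, `λ = newtonFarLaplacian r₀ r₁`
the (smooth, compactly supported, unit-mass) Laplacian of the far kernel `(1-θ)Γ`. [folklore] -/
def newtonFarSmoothing (r₀ r₁ : ℝ) (g : ℝ³ → ℝ) (x : ℝ³) : ℝ :=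
  ∫ z, newtonFarLaplacian r₀ r₁ z * g (x - z)

/-- Unfolding `N[g]`. [folklore] -/
theorem newtonNearPotential_apply (r₀ r₁ : ℝ) (g : ℝ³ → ℝ) (x : ℝ³) :
    newtonNearPotential r₀ r₁ g x = ∫ z, newtonNear r₀ r₁ z * g (x - z) := rfl

/-- Unfolding `Λ[g]`. [folklore] -/
theorem newtonFarSmoothing_apply (r₀ r₁ : ℝ) (g : ℝ³ → ℝ) (x : ℝ³) :
    newtonFarSmoothing r₀ r₁ g x = ∫ z, newtonFarLaplacian r₀ r₁ z * g (x - z) := rfl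

/-- `Γ₀` vanishes off the ball of radius `r₁` (strict form). [folklore] -/
theorem newtonNear_eq_zero_of_lt (h₀ : 0 ≤ r₀) (h₁ : r₀ < r₁) :
    ∀ z : ℝ³, r₁ < ‖z‖ → newtonNear r₀ r₁ z = 0 := fun _ hz =>
  newtonNear_eq_zero h₀ h₁ hz.le

/-- `λ` vanishes off the ball of radius `r₁` (strict form). [folklore] -/
theorem newtonFarLaplacian_eq_zero_of_lt' (h₀ : 0 ≤ r₀) (h₁ : r₀ < r₁) :
    ∀ z : ℝ³, r₁ < ‖z‖ → newtonFarLaplacian r₀ r₁ z = 0 := fun _ hz =>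
  newtonFarLaplacian_eq_zero_of_gt h₀ h₁ hz

/-- `N[g]` in the `•` form of `HarmonicProbe`. [folklore] -/
theorem newtonNearPotential_eq_smul (r₀ r₁ : ℝ) (g : ℝ³ → ℝ) :
    newtonNearPotential r₀ r₁ g = fun x => ∫ z, newtonNear r₀ r₁ z • g (x - z) := by
  funext x; simp only [newtonNearPotential, smul_eq_mul]

/-- `Λ[g]` in the `•` form of `HarmonicProbe`. [folklore] -/
theorem newtonFarSmoothing_eq_smul (r₀ r₁ : ℝ) (g : ℝ³ → ℝ) :
    newtonFarSmoothing r₀ r₁ g = fun x => ∫ z, newtonFarLaplacian r₀ r₁ z • g (x - z) := by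
  funext x; simp only [newtonFarSmoothing, smul_eq_mul]

/-- `Λ[g]` is the convolution `λ ⋆ g`. [folklore] -/
theorem newtonFarSmoothing_eq_convolution (r₀ r₁ : ℝ) (g : ℝ³ → ℝ) :
    newtonFarSmoothing r₀ r₁ g = newtonFarLaplacian r₀ r₁ ⋆[ContinuousLinearMap.lsmul ℝ ℝ, volume] g := by
  funext x; rw [convolution_lsmul_apply]; rfl

/-! ### Regularity and support of the truncated potential -/

/-- **`N[g] ∈ Cⁿ` for `g ∈ Cⁿ`** (`Γ₀ ∈ L¹` with compact support: differentiation under the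
integral, `HarmonicProbe.contDiff_integral_smul_comp_sub`). [folklore] -/
theorem contDiff_newtonNearPotential (h₀ : 0 ≤ r₀) (h₁ : r₀ < r₁) (n : ℕ) (hg : ContDiff ℝ n g) :
    ContDiff ℝ n (newtonNearPotential r₀ r₁ g) := by
  rw [newtonNearPotential_eq_smul]
  exact contDiff_integral_smul_comp_sub (integrable_newtonNear h₀ h₁)
    (newtonNear_eq_zero_of_lt h₀ h₁) n hg

/-- `N[g] ∈ C^∞` for `g ∈ C^∞`. [folklore] -/
theorem contDiff_newtonNearPotential_top (h₀ : 0 ≤ r₀) (h₁ : r₀ < r₁) (hg : ContDiff ℝ ∞ g) :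
    ContDiff ℝ ∞ (newtonNearPotential r₀ r₁ g) :=
  contDiff_infty.2 fun n => contDiff_newtonNearPotential h₀ h₁ n (contDiff_infty.1 hg n)

/-- `N[g](x) = 0` as soon as `g` vanishes on the ball `B̄(x, r₁)`. [folklore] -/
theorem newtonNearPotential_eq_zero_of_forall (h₀ : 0 ≤ r₀) (h₁ : r₀ < r₁) {x : ℝ³}
    (hx : ∀ z : ℝ³, ‖z‖ ≤ r₁ → g (x - z) = 0) : newtonNearPotential r₀ r₁ g x = 0 := by
  rw [newtonNearPotential_apply]
  refine integral_eq_zero_of_ae (Eventually.of_forall fun z => ?_)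
  by_cases hz : ‖z‖ ≤ r₁
  · simp only [hx z hz, mul_zero, Pi.zero_apply]
  · simp only [newtonNear_eq_zero h₀ h₁ (not_le.1 hz).le, zero_mul, Pi.zero_apply]

/-- **`N[g]` has compact support** when `g` has: `supp N[g] ⊆ tsupport g + B̄(0, r₁)`. [folklore] -/
theorem hasCompactSupport_newtonNearPotential (h₀ : 0 ≤ r₀) (h₁ : r₀ < r₁) (hgc : HasCompactSupport g) :
    HasCompactSupport (newtonNearPotential r₀ r₁ g) := by
  refine HasCompactSupport.intro (IsCompact.add hgc (isCompact_closedBall (0 : ℝ³) r₁))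
    fun x hx => ?_
  refine newtonNearPotential_eq_zero_of_forall h₀ h₁ fun z hz => ?_
  by_contra hne
  exact hx ⟨x - z, subset_tsupport _ (mem_support.2 hne), z, mem_closedBall_zero_iff.2 hz,
    sub_add_cancel x z⟩

/-- `Λ[g](x) = 0` as soon as `g` vanishes on the ball `B̄(x, r₁)`. [folklore] -/
theorem newtonFarSmoothing_eq_zero_of_forall (h₀ : 0 ≤ r₀) (h₁ : r₀ < r₁) {x : ℝ³}
    (hx : ∀ z : ℝ³, ‖z‖ ≤ r₁ → g (x - z) = 0) : newtonFarSmoothing r₀ r₁ g x = 0 := by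
  rw [newtonFarSmoothing_apply]
  refine integral_eq_zero_of_ae (Eventually.of_forall fun z => ?_)
  by_cases hz : ‖z‖ ≤ r₁
  · simp only [hx z hz, mul_zero, Pi.zero_apply]
  · simp only [newtonFarLaplacian_eq_zero_of_gt h₀ h₁ (not_le.1 hz), zero_mul, Pi.zero_apply]

/-- `Λ[g]` has compact support when `g` has. [folklore] -/
theorem hasCompactSupport_newtonFarSmoothing (h₀ : 0 ≤ r₀) (h₁ : r₀ < r₁) (hgc : HasCompactSupport g) :
    HasCompactSupport (newtonFarSmoothing r₀ r₁ g) := by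
  rw [newtonFarSmoothing_eq_convolution]
  exact hasCompactSupport_convolution (hasCompactSupport_newtonFarLaplacian h₀ h₁) hgc

/-- `Λ[g]` is continuous for continuous `g`. [folklore] -/
theorem continuous_newtonFarSmoothing (h₀ : 0 < r₀) (h₁ : r₀ < r₁) (hg : Continuous g) :
    Continuous (newtonFarSmoothing r₀ r₁ g) := by
  rw [newtonFarSmoothing_eq_smul]
  exact continuous_integral_smul_comp_sub (integrable_newtonFarLaplacian h₀ h₁)
    (newtonFarLaplacian_eq_zero_of_lt' h₀.le h₁) hg

/-- `Λ[g] ∈ Cⁿ` for `g ∈ Cⁿ`. [folklore] -/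
theorem contDiff_newtonFarSmoothing (h₀ : 0 < r₀) (h₁ : r₀ < r₁) (n : ℕ) (hg : ContDiff ℝ n g) :
    ContDiff ℝ n (newtonFarSmoothing r₀ r₁ g) := by
  rw [newtonFarSmoothing_eq_smul]
  exact contDiff_integral_smul_comp_sub (integrable_newtonFarLaplacian h₀ h₁)
    (newtonFarLaplacian_eq_zero_of_lt' h₀.le h₁) n hg

/-! ### Derivatives of the truncated potential -/

/-- **`∂ₐN[g] = N[∂ₐg]`** for `g ∈ C¹`. [folklore] -/
theorem fderiv_newtonNearPotential_apply (h₀ : 0 ≤ r₀) (h₁ : r₀ < r₁) (hg : ContDiff ℝ 1 g)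
    (x a : ℝ³) :
    fderiv ℝ (newtonNearPotential r₀ r₁ g) x a =
      newtonNearPotential r₀ r₁ (fun w => fderiv ℝ g w a) x := by
  have h := fderiv_integral_smul_comp_sub_apply (integrable_newtonNear h₀ h₁)
    (newtonNear_eq_zero_of_lt h₀ h₁) hg x a
  rw [newtonNearPotential_eq_smul, newtonNearPotential_apply]
  simpa only [smul_eq_mul] using h

/-- **`∂_c∂ₐN[g] = N[∂_c∂ₐg]`** for `g ∈ C²`. [folklore] -/
theorem fderiv_fderiv_newtonNearPotential_apply (h₀ : 0 ≤ r₀) (h₁ : r₀ < r₁)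
    (hg : ContDiff ℝ 2 g) (x a c : ℝ³) :
    fderiv ℝ (fun y => fderiv ℝ (newtonNearPotential r₀ r₁ g) y a) x c =
      newtonNearPotential r₀ r₁ (fun w => fderiv ℝ (fun y => fderiv ℝ g y a) w c) x := by
  have hg1 : ContDiff ℝ 1 g := hg.of_le one_le_two
  have hga : ContDiff ℝ 1 fun y => fderiv ℝ g y a :=
    (hg.fderiv_right (m := 1) le_rfl).clm_apply contDiff_const
  have hfun : (fun y => fderiv ℝ (newtonNearPotential r₀ r₁ g) y a) =
      newtonNearPotential r₀ r₁ (fun w => fderiv ℝ g w a) :=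
    funext fun y => fderiv_newtonNearPotential_apply h₀ h₁ hg1 y a
  rw [hfun, fderiv_newtonNearPotential_apply h₀ h₁ hga x c]

/-- **`∂ₐΛ[g] = Λ[∂ₐg]`** for `g ∈ C¹`. [folklore] -/
theorem fderiv_newtonFarSmoothing_apply (h₀ : 0 < r₀) (h₁ : r₀ < r₁) (hg : ContDiff ℝ 1 g)
    (x a : ℝ³) :
    fderiv ℝ (newtonFarSmoothing r₀ r₁ g) x a =
      newtonFarSmoothing r₀ r₁ (fun w => fderiv ℝ g w a) x := by
  have h := fderiv_integral_smul_comp_sub_apply (integrable_newtonFarLaplacian h₀ h₁)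
    (newtonFarLaplacian_eq_zero_of_lt' h₀.le h₁) hg x a
  rw [newtonFarSmoothing_eq_smul, newtonFarSmoothing_apply]
  simpa only [smul_eq_mul] using h

/-! ### Green's representation at scale `r₁`: `ΔN[g] = g - Λ[g]` -/

/-- **Green's representation formula at a fixed scale** (Gilbarg–Trudinger (2.16)–(2.17),
localised): for `g ∈ C²` and every `x`, `N[Δg](x) = g(x) - Λ[g](x)`, i.e.
`g = N[Δg] + Λ[g]` (`integral_newtonNear_mul_laplacian` for `φ = g(x - ·)`). [cite: GilbargTrudinger2001, (2.17)] -/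
theorem newtonNearPotential_laplacian (h₀ : 0 < r₀) (h₁ : r₀ < r₁) (hg : ContDiff ℝ 2 g) (x : ℝ³) :
    newtonNearPotential r₀ r₁ (Δ g) x = g x - newtonFarSmoothing r₀ r₁ g x := by
  rw [newtonNearPotential_apply, newtonFarSmoothing_apply]
  have hφ : ContDiff ℝ 2 fun w : ℝ³ => g (x - w) := hg.comp (contDiff_const.sub contDiff_id)
  have h2 := integral_newtonNear_mul_laplacian h₀ h₁ hφ
  simp only [laplacian_comp_const_sub, sub_zero] at h2
  exact h2

/-- `g = N[Δg] + Λ[g]` for `g ∈ C²` (Green's representation, rearranged). [cite: GilbargTrudinger2001, (2.17)] -/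
theorem eq_newtonNearPotential_laplacian_add (h₀ : 0 < r₀) (h₁ : r₀ < r₁) (hg : ContDiff ℝ 2 g)
    (x : ℝ³) : g x = newtonNearPotential r₀ r₁ (Δ g) x + newtonFarSmoothing r₀ r₁ g x := by
  rw [newtonNearPotential_laplacian h₀ h₁ hg x, sub_add_cancel]

/-- **`ΔN[g] = N[Δg] = g - Λ[g]`** for `g ∈ C²`: the Laplacian passes under the integral
(`laplacian_integral_mul_comp_sub`) and Green's representation applies. [cite: GilbargTrudinger2001, (2.17)] -/
theorem laplacian_newtonNearPotential (h₀ : 0 < r₀) (h₁ : r₀ < r₁) (hg : ContDiff ℝ 2 g) (x : ℝ³) :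
    (Δ (newtonNearPotential r₀ r₁ g)) x = g x - newtonFarSmoothing r₀ r₁ g x := by
  have h1 : (Δ (newtonNearPotential r₀ r₁ g)) x = ∫ z, newtonNear r₀ r₁ z * (Δ g) (x - z) :=
    laplacian_integral_mul_comp_sub (integrable_newtonNear h₀.le h₁)
      (newtonNear_eq_zero_of_lt h₀.le h₁) hg x
  rw [h1, ← newtonNearPotential_apply, newtonNearPotential_laplacian h₀ h₁ hg x]

/-! ### Cauchy–Schwarz for real integrals -/

/-- **Cauchy–Schwarz**: `∫ |f| |g| ≤ √(∫ f²) √(∫ g²)` for real `f, g ∈ L²`. [folklore] -/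
theorem integral_abs_mul_abs_le_sqrt {α : Type*} [MeasurableSpace α] {μ : Measure α} {f g : α → ℝ}
    (hf : MemLp f 2 μ) (hg : MemLp g 2 μ) :
    ∫ x, |f x| * |g x| ∂μ ≤ Real.sqrt (∫ x, f x ^ 2 ∂μ) * Real.sqrt (∫ x, g x ^ 2 ∂μ) := by
  have hf' : MemLp (fun x => |f x|) (ENNReal.ofReal 2) μ := by
    rw [show ENNReal.ofReal 2 = 2 by norm_num]; exact hf.abs
  have hg' : MemLp (fun x => |g x|) (ENNReal.ofReal 2) μ := by
    rw [show ENNReal.ofReal 2 = 2 by norm_num]; exact hg.abs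
  have h := integral_mul_le_Lp_mul_Lq_of_nonneg Real.HolderConjugate.two_two
    (Eventually.of_forall fun x => abs_nonneg (f x)) (Eventually.of_forall fun x => abs_nonneg (g x))
    hf' hg'
  have e1 : ∀ x, |f x| ^ (2:ℝ) = f x ^ 2 := fun x => by rw [Real.rpow_two, sq_abs]
  have e2 : ∀ x, |g x| ^ (2:ℝ) = g x ^ 2 := fun x => by rw [Real.rpow_two, sq_abs]
  simp only [e1, e2] at h
  rwa [← Real.sqrt_eq_rpow, ← Real.sqrt_eq_rpow] at h

/-! ### The smoothing remainder with the derivative on the kernel -/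

/-- `Λ[g](x) = ∫ g(y) λ(x - y) dy` (the substitution `y = x - z`). [folklore] -/
theorem newtonFarSmoothing_eq_integral_kernel (r₀ r₁ : ℝ) (g : ℝ³ → ℝ) (x : ℝ³) :
    newtonFarSmoothing r₀ r₁ g x = ∫ y, g y * newtonFarLaplacian r₀ r₁ (x - y) := by
  rw [newtonFarSmoothing_apply]
  have h := integral_sub_left_eq_self (fun y => g y * newtonFarLaplacian r₀ r₁ (x - y)) volume x
  simp only [sub_sub_cancel] at h
  rw [← h]
  refine integral_congr_ae (Eventually.of_forall fun z => ?_)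
  simp only [mul_comm]

/-- A compactly supported function vanishes off some ball about the origin. [folklore] -/
theorem exists_eq_zero_of_hasCompactSupport {f : ℝ³ → ℝ} (hfc : HasCompactSupport f) :
    ∃ ρ : ℝ, ∀ y : ℝ³, ρ < ‖y‖ → f y = 0 := by
  obtain ⟨ρ, hρ⟩ := hfc.isCompact.isBounded.subset_closedBall 0 |>.imp fun ρ h => h
  refine ⟨ρ, fun y hy => ?_⟩
  by_contra hne
  have hmem : y ∈ closedBall (0 : ℝ³) ρ := hρ (subset_tsupport _ (mem_support.2 hne))
  rw [mem_closedBall_zero_iff] at hmem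
  exact absurd hmem (not_le.2 hy)

/-- **`∂ₐΛ[g](x) = ∫ g(y) ∂ₐλ(x - y) dy`**: the derivative of the smoothing remainder with the
derivative on the (smooth) kernel, for `g` continuous with compact support. [folklore] -/
theorem fderiv_newtonFarSmoothing_eq_integral_kernel (h₀ : 0 < r₀) (h₁ : r₀ < r₁)
    (hg : Continuous g) (hgc : HasCompactSupport g) (x a : ℝ³) :
    fderiv ℝ (newtonFarSmoothing r₀ r₁ g) x a =
      ∫ y, g y * fderiv ℝ (newtonFarLaplacian r₀ r₁) (x - y) a := by
  obtain ⟨ρ, hρ⟩ := exists_eq_zero_of_hasCompactSupport hgc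
  have hfun : newtonFarSmoothing r₀ r₁ g = fun x => ∫ y, g y • newtonFarLaplacian r₀ r₁ (x - y) := by
    funext x'; rw [newtonFarSmoothing_eq_integral_kernel]; rfl
  rw [hfun]
  have h := fderiv_integral_smul_comp_sub_apply (hg.integrable_of_hasCompactSupport hgc) hρ
    ((contDiff_newtonFarLaplacian h₀ h₁ (n := 1))) x a
  simpa only [smul_eq_mul] using h

/-- `∫ g² ` for the shifted kernel equals the unshifted one: `∫ (∂ₐλ(x - y))² dy = ∫ (∂ₐλ)²`.
[folklore] -/
theorem integral_sq_fderiv_kernel_comp_sub (r₀ r₁ : ℝ) (x a : ℝ³) :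
    ∫ y, (fderiv ℝ (newtonFarLaplacian r₀ r₁) (x - y) a) ^ 2 =
      ∫ z, (fderiv ℝ (newtonFarLaplacian r₀ r₁) z a) ^ 2 :=
  integral_sub_left_eq_self (fun z => (fderiv ℝ (newtonFarLaplacian r₀ r₁) z a) ^ 2) volume x

/-- `∫ |∂ₐλ(x - y)| dy = ∫ |∂ₐλ|`. [folklore] -/
theorem integral_abs_fderiv_kernel_comp_sub (r₀ r₁ : ℝ) (x a : ℝ³) :
    ∫ y, |fderiv ℝ (newtonFarLaplacian r₀ r₁) (x - y) a| =
      ∫ z, |fderiv ℝ (newtonFarLaplacian r₀ r₁) z a| :=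
  integral_sub_left_eq_self (fun z => |fderiv ℝ (newtonFarLaplacian r₀ r₁) z a|) volume x

/-- The shifted kernel derivative `y ↦ ∂ₐλ(x - y)` is continuous with compact support. [folklore] -/
theorem continuous_fderiv_kernel_comp_sub (h₀ : 0 < r₀) (h₁ : r₀ < r₁) (x a : ℝ³) :
    Continuous fun y => fderiv ℝ (newtonFarLaplacian r₀ r₁) (x - y) a :=
  (((contDiff_newtonFarLaplacian h₀ h₁ (n := 1)).continuous_fderiv one_ne_zero).clm_apply
    continuous_const).comp (continuous_const.sub continuous_id)

/-- The shifted kernel derivative has compact support. [folklore] -/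
theorem hasCompactSupport_fderiv_kernel_comp_sub (h₀ : 0 < r₀) (h₁ : r₀ < r₁) (x a : ℝ³) :
    HasCompactSupport fun y => fderiv ℝ (newtonFarLaplacian r₀ r₁) (x - y) a := by
  refine HasCompactSupport.intro (isCompact_closedBall x r₁) fun y hy => ?_
  rw [mem_closedBall, dist_comm, dist_eq_norm, not_le] at hy
  have hzero : fderiv ℝ (newtonFarLaplacian r₀ r₁) (x - y) = 0 := by
    refine fderiv_of_notMem_tsupport ℝ fun hmem => ?_
    have := tsupport_newtonFarLaplacian_subset h₀.le h₁ hmem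
    rw [mem_closedBall_zero_iff] at this
    exact absurd this (not_le.2 hy)
  rw [hzero]
  rfl

/-- **Pointwise bound, `L²` form**: `|∂ₐΛ[g](x)| ≤ √(∫ g²) · √(∫ (∂ₐλ)²)` (Cauchy–Schwarz).
[folklore] -/
theorem abs_fderiv_newtonFarSmoothing_le_sqrt (h₀ : 0 < r₀) (h₁ : r₀ < r₁) (hg : Continuous g)
    (hgc : HasCompactSupport g) (x a : ℝ³) :
    |fderiv ℝ (newtonFarSmoothing r₀ r₁ g) x a| ≤
      Real.sqrt (∫ y, g y ^ 2) * Real.sqrt (∫ z, (fderiv ℝ (newtonFarLaplacian r₀ r₁) z a) ^ 2) := by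
  rw [fderiv_newtonFarSmoothing_eq_integral_kernel h₀ h₁ hg hgc, ← integral_sq_fderiv_kernel_comp_sub r₀ r₁ x a]
  have hkc := continuous_fderiv_kernel_comp_sub h₀ h₁ x a
  have hks := hasCompactSupport_fderiv_kernel_comp_sub h₀ h₁ x a
  calc |∫ y, g y * fderiv ℝ (newtonFarLaplacian r₀ r₁) (x - y) a|
      ≤ ∫ y, |g y * fderiv ℝ (newtonFarLaplacian r₀ r₁) (x - y) a| := abs_integral_le_integral_abs
    _ = ∫ y, |g y| * |fderiv ℝ (newtonFarLaplacian r₀ r₁) (x - y) a| := by simp only [abs_mul]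
    _ ≤ Real.sqrt (∫ y, g y ^ 2) *
          Real.sqrt (∫ y, (fderiv ℝ (newtonFarLaplacian r₀ r₁) (x - y) a) ^ 2) :=
        integral_abs_mul_abs_le_sqrt (hg.memLp_of_hasCompactSupport hgc)
          (hkc.memLp_of_hasCompactSupport hks)

/-- **Pointwise bound, `L^∞` form**: if `|g| ≤ s` then `|∂ₐΛ[g](x)| ≤ s ∫ |∂ₐλ|`. [folklore] -/
theorem abs_fderiv_newtonFarSmoothing_le_of_abs_le (h₀ : 0 < r₀) (h₁ : r₀ < r₁) (hg : Continuous g)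
    (hgc : HasCompactSupport g) {s : ℝ} (hs : ∀ y, |g y| ≤ s) (x a : ℝ³) :
    |fderiv ℝ (newtonFarSmoothing r₀ r₁ g) x a| ≤
      s * ∫ z, |fderiv ℝ (newtonFarLaplacian r₀ r₁) z a| := by
  rw [fderiv_newtonFarSmoothing_eq_integral_kernel h₀ h₁ hg hgc, ← integral_abs_fderiv_kernel_comp_sub r₀ r₁ x a,
    ← integral_const_mul]
  have hkc := continuous_fderiv_kernel_comp_sub h₀ h₁ x a
  have hks := hasCompactSupport_fderiv_kernel_comp_sub h₀ h₁ x a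
  have hki : Integrable fun y => |fderiv ℝ (newtonFarLaplacian r₀ r₁) (x - y) a| :=
    (hkc.integrable_of_hasCompactSupport hks).abs
  calc |∫ y, g y * fderiv ℝ (newtonFarLaplacian r₀ r₁) (x - y) a|
      ≤ ∫ y, |g y * fderiv ℝ (newtonFarLaplacian r₀ r₁) (x - y) a| := abs_integral_le_integral_abs
    _ ≤ ∫ y, s * |fderiv ℝ (newtonFarLaplacian r₀ r₁) (x - y) a| := by
        refine integral_mono_of_nonneg (Eventually.of_forall fun y => abs_nonneg _)
          (hki.const_mul s) (Eventually.of_forall fun y => ?_)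
        show |g y * fderiv ℝ (newtonFarLaplacian r₀ r₁) (x - y) a| ≤
          s * |fderiv ℝ (newtonFarLaplacian r₀ r₁) (x - y) a|
        rw [abs_mul]
        exact mul_le_mul_of_nonneg_right (hs y) (abs_nonneg _)

/-! ### Young's inequality for the smoothing remainder -/

/-- **`∫ Λ[g]² ≤ M² ∫ g²`, `M = ∫|λ|`** (Young `L¹ * L² → L²`, the tree's
`Literature.Analysis.UnboundedOperators.eLpNorm_convolution_le_lintegral_enorm_mul`), for continuous compactly supported `g`.
[folklore] -/
theorem integral_sq_newtonFarSmoothing_le (h₀ : 0 < r₀) (h₁ : r₀ < r₁) (hg : Continuous g)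
    (hgc : HasCompactSupport g) :
    ∫ x, newtonFarSmoothing r₀ r₁ g x ^ 2 ≤
      (∫ z, |newtonFarLaplacian r₀ r₁ z|) ^ 2 * ∫ x, g x ^ 2 := by
  set lam := newtonFarLaplacian r₀ r₁ with hlam
  have hlc : Continuous lam := continuous_newtonFarLaplacian h₀ h₁
  have hli : Integrable lam := integrable_newtonFarLaplacian h₀ h₁
  have hY := Literature.Analysis.UnboundedOperators.eLpNorm_convolution_le_lintegral_enorm_mul
    (μ := volume) (K := lam) hlc.aestronglyMeasurable (f := g) hg.aestronglyMeasurable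
    (p := 2) (by norm_num)
  rw [← newtonFarSmoothing_eq_convolution] at hY
  have hΛc : Continuous (newtonFarSmoothing r₀ r₁ g) := continuous_newtonFarSmoothing h₀ h₁ hg
  have hΛs : HasCompactSupport (newtonFarSmoothing r₀ r₁ g) :=
    hasCompactSupport_newtonFarSmoothing h₀.le h₁ hgc
  have hΛ2 : MemLp (newtonFarSmoothing r₀ r₁ g) 2 volume := hΛc.memLp_of_hasCompactSupport hΛs
  have hg2 : MemLp g 2 volume := hg.memLp_of_hasCompactSupport hgc
  have hM0 : 0 ≤ ∫ z, ‖lam z‖ := integral_nonneg fun _ => norm_nonneg _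
  rw [eLpNorm_two_eq_ofReal_sqrt hΛ2, eLpNorm_two_eq_ofReal_sqrt hg2,
    ← ofReal_integral_norm_eq_lintegral_enorm hli, ← ENNReal.ofReal_mul hM0,
    ENNReal.ofReal_le_ofReal_iff (mul_nonneg hM0 (Real.sqrt_nonneg _))] at hY
  have hA0 : 0 ≤ ∫ x, newtonFarSmoothing r₀ r₁ g x ^ 2 := integral_nonneg fun _ => sq_nonneg _
  have hB0 : 0 ≤ ∫ x, g x ^ 2 := integral_nonneg fun _ => sq_nonneg _
  have hnorm : (∫ z, ‖lam z‖) = ∫ z, |lam z| := rfl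
  calc ∫ x, newtonFarSmoothing r₀ r₁ g x ^ 2
      = (Real.sqrt (∫ x, newtonFarSmoothing r₀ r₁ g x ^ 2)) ^ 2 := (Real.sq_sqrt hA0).symm
    _ ≤ ((∫ z, ‖lam z‖) * Real.sqrt (∫ x, g x ^ 2)) ^ 2 :=
        pow_le_pow_left₀ (Real.sqrt_nonneg _) hY 2
    _ = (∫ z, |lam z|) ^ 2 * ∫ x, g x ^ 2 := by rw [mul_pow, Real.sq_sqrt hB0, hnorm]

/-- The mass `M = ∫|λ|` is scale invariant: for the radii `(r/2, r)` it is the absolute constant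
`regLaplacianMass = ∫|λ_{1/2,1}|`. [folklore] -/
theorem integral_abs_newtonFarLaplacian_half {r : ℝ} (hr : 0 < r) :
    ∫ z, |newtonFarLaplacian (r / 2) r z| = regLaplacianMass := by
  have h := integral_abs_newtonFarLaplacian_scale hr (1 / 2) 1
  rw [mul_one, show r * (1 / 2) = r / 2 by ring] at h
  exact h

/-! ### The `L²` bound for the Hessian of the truncated potential -/

/-- `∫ f²` makes sense for continuous compactly supported `f`. [folklore] -/
theorem integrable_sq_of_hasCompactSupport {f : ℝ³ → ℝ} (hf : Continuous f)
    (hfc : HasCompactSupport f) : Integrable fun x => f x ^ 2 := by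
  have h : HasCompactSupport fun x => f x ^ 2 :=
    hfc.comp_left (g := fun t : ℝ => t ^ 2) (zero_pow two_ne_zero)
  exact (hf.pow 2).integrable_of_hasCompactSupport h


/-- **`∫ (ΔN[g])² ≤ 2(1 + M²) ∫ g²`**: `ΔN[g] = g - Λ[g]`, `(a - b)² ≤ 2a² + 2b²` and Young.
[folklore] -/
theorem integral_laplacian_newtonNearPotential_sq_le (h₀ : 0 < r₀) (h₁ : r₀ < r₁)
    (hg : ContDiff ℝ 2 g) (hgc : HasCompactSupport g) :
    ∫ x, (Δ (newtonNearPotential r₀ r₁ g)) x ^ 2 ≤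
      2 * (1 + (∫ z, |newtonFarLaplacian r₀ r₁ z|) ^ 2) * ∫ x, g x ^ 2 := by
  set M : ℝ := ∫ z, |newtonFarLaplacian r₀ r₁ z| with hM
  have hgc' : Continuous g := hg.continuous
  have hΛc : Continuous (newtonFarSmoothing r₀ r₁ g) := continuous_newtonFarSmoothing h₀ h₁ hgc'
  have hΛs : HasCompactSupport (newtonFarSmoothing r₀ r₁ g) :=
    hasCompactSupport_newtonFarSmoothing h₀.le h₁ hgc
  have heq : (fun x => (Δ (newtonNearPotential r₀ r₁ g)) x ^ 2) =
      fun x => (g x - newtonFarSmoothing r₀ r₁ g x) ^ 2 :=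
    funext fun x => by rw [laplacian_newtonNearPotential h₀ h₁ hg x]
  rw [heq]
  have hig : Integrable fun x => g x ^ 2 := integrable_sq_of_hasCompactSupport hgc' hgc
  have hiΛ : Integrable fun x => newtonFarSmoothing r₀ r₁ g x ^ 2 :=
    integrable_sq_of_hasCompactSupport hΛc hΛs
  have hpt : ∀ x, (g x - newtonFarSmoothing r₀ r₁ g x) ^ 2 ≤
      2 * g x ^ 2 + 2 * newtonFarSmoothing r₀ r₁ g x ^ 2 := fun x => by
    nlinarith [sq_nonneg (g x + newtonFarSmoothing r₀ r₁ g x)]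
  have hdiff : Integrable fun x => (g x - newtonFarSmoothing r₀ r₁ g x) ^ 2 :=
    integrable_sq_of_hasCompactSupport (f := g - newtonFarSmoothing r₀ r₁ g) (hgc'.sub hΛc)
      (hgc.sub hΛs)
  calc ∫ x, (g x - newtonFarSmoothing r₀ r₁ g x) ^ 2
      ≤ ∫ x, (2 * g x ^ 2 + 2 * newtonFarSmoothing r₀ r₁ g x ^ 2) :=
        integral_mono hdiff ((hig.const_mul 2).add (hiΛ.const_mul 2)) hpt
    _ = 2 * (∫ x, g x ^ 2) + 2 * (∫ x, newtonFarSmoothing r₀ r₁ g x ^ 2) := by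
        rw [integral_add (hig.const_mul 2) (hiΛ.const_mul 2), integral_const_mul, integral_const_mul]
    _ ≤ 2 * (∫ x, g x ^ 2) + 2 * (M ^ 2 * ∫ x, g x ^ 2) := by
        gcongr
        exact integral_sq_newtonFarSmoothing_le h₀ h₁ hgc' hgc
    _ = 2 * (1 + M ^ 2) * ∫ x, g x ^ 2 := by ring

/-- **The `L²` bound for the Hessian of the truncated Newtonian potential** (Tao: "From
Plancherel's theorem we have `‖∇Δ⁻¹∇(ψᵢω)‖_{L²} ≲ ‖ψᵢω‖_{L²}`"; here by the Hessian–Laplacian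
identity and Green's representation, sharp constant for `Δ⁻¹` replaced by `2(1 + M²)` for the
truncated kernel): for `g ∈ C³` with compact support and any orthonormal basis `b`,
`Σᵢ Σⱼ ∫ (∂ⱼ∂ᵢN[g])² ≤ 2(1 + M²) ∫ g²`. [cite: Tao2011, §10, proof of Thm. 10.1 (Plancherel step for Y₆,₁)] -/
theorem sum_integral_sq_fderiv_fderiv_newtonNearPotential_le {ι : Type*} [Fintype ι]
    (b : OrthonormalBasis ι ℝ ℝ³) (h₀ : 0 < r₀) (h₁ : r₀ < r₁) (hg : ContDiff ℝ 3 g)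
    (hgc : HasCompactSupport g) :
    ∑ i, ∑ j, ∫ x, (fderiv ℝ (fun y => fderiv ℝ (newtonNearPotential r₀ r₁ g) y (b i)) x (b j)) ^ 2 ≤
      2 * (1 + (∫ z, |newtonFarLaplacian r₀ r₁ z|) ^ 2) * ∫ x, g x ^ 2 := by
  rw [integral_sum_sq_fderiv_fderiv_eq_integral_laplacian_sq b
    (contDiff_newtonNearPotential h₀.le h₁ 3 hg) (hasCompactSupport_newtonNearPotential h₀.le h₁ hgc)]
  exact integral_laplacian_newtonNearPotential_sq_le h₀ h₁ (hg.of_le (by norm_num)) hgc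

/-- Each entry of the Hessian of `N[g]` is bounded in `L²` by `√(2(1+M²)) ‖g‖_{L²}`:
`∫ (∂ⱼ∂ᵢN[g])² ≤ 2(1 + M²) ∫ g²`. [folklore] -/
theorem integral_sq_fderiv_fderiv_newtonNearPotential_le {ι : Type*} [Fintype ι]
    (b : OrthonormalBasis ι ℝ ℝ³) (h₀ : 0 < r₀) (h₁ : r₀ < r₁) (hg : ContDiff ℝ 3 g)
    (hgc : HasCompactSupport g) (i j : ι) :
    ∫ x, (fderiv ℝ (fun y => fderiv ℝ (newtonNearPotential r₀ r₁ g) y (b i)) x (b j)) ^ 2 ≤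
      2 * (1 + (∫ z, |newtonFarLaplacian r₀ r₁ z|) ^ 2) * ∫ x, g x ^ 2 := by
  refine le_trans ?_ (sum_integral_sq_fderiv_fderiv_newtonNearPotential_le b h₀ h₁ hg hgc)
  have hnn : ∀ i' j', 0 ≤ ∫ x, (fderiv ℝ (fun y =>
      fderiv ℝ (newtonNearPotential r₀ r₁ g) y (b i')) x (b j')) ^ 2 :=
    fun _ _ => integral_nonneg fun _ => sq_nonneg _
  calc ∫ x, (fderiv ℝ (fun y => fderiv ℝ (newtonNearPotential r₀ r₁ g) y (b i)) x (b j)) ^ 2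
      ≤ ∑ j', ∫ x, (fderiv ℝ (fun y => fderiv ℝ (newtonNearPotential r₀ r₁ g) y (b i)) x (b j')) ^ 2 :=
        Finset.single_le_sum (f := fun j' => ∫ x, (fderiv ℝ (fun y =>
          fderiv ℝ (newtonNearPotential r₀ r₁ g) y (b i)) x (b j')) ^ 2)
          (fun j' _ => hnn i j') (Finset.mem_univ j)
    _ ≤ ∑ i', ∑ j', ∫ x, (fderiv ℝ (fun y =>
          fderiv ℝ (newtonNearPotential r₀ r₁ g) y (b i')) x (b j')) ^ 2 :=
        Finset.single_le_sum (f := fun i' => ∑ j', ∫ x, (fderiv ℝ (fun y =>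
          fderiv ℝ (newtonNearPotential r₀ r₁ g) y (b i')) x (b j')) ^ 2)
          (fun i' _ => Finset.sum_nonneg fun j' _ => hnn i' j') (Finset.mem_univ i)

end Potential

end Literature.Analysis.FluidPDE

end
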